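import Summits.CriticalPhenomena.PercolationContinuityZ3.Theorems.PercNearOneGluingNoHeavyLowerTailSunflowerChainCertificateChecker
import HarnessLib

/-!
# `NoHeavyLowerTail` (crux stmt-CriticalPhenomena-4575), chain certificates — COMPILED CHECK, generic pattern, cell prefix `[0,0]`

Support file (seat `prim-ineq-prove-1` gen 33; `--supports stmt-CriticalPhenomena-4575`, `--computational`: compiled evaluation by `native_decide`, axioms =
standard + `Lean.ofReduceBool`, confined to the theorems of this file).  Part of the kernel replay of `ChainCert.ThreeBlockMedianCertificate`; soundness of the
checker: …ChainCertificateSound/…Final; timings: run/shared/lean/prim/prim-ineq-prove-1/FINDING-CHAINCERT-prove1-g33.md §4f–g.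
EXPECTED elaboration: ≈ 3.5–4.5 min (the seat's run of exactly this statement: 282 s wall incl. ≈ 70 s for the imports' dev-file elaboration; rc 0, value `true`).
-/

namespace Summit.CriticalPhenomena.PercolationContinuityZ3.Theorems.SunflowerPartition

namespace ChainCert

/-- **Generic pattern, cell prefix `[0,0]`: every admissible block-symmetry representative has `X_loc ≥ 0`** (compiled evaluation). [this work] -/
theorem check_gen00 : checkPatternFrom bgen [0, 0] = true := by
  native_decide

end ChainCert

end Summit.CriticalPhenomena.PercolationContinuityZ3.Theorems.SunflowerPartition
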